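import Summits.AtomisticToContinuum.HydrodynamicLimit.Theorems.AntiMazurCoboundariesCorrectorPressureDecayTangentTightnessLaplace
import Literature.MathematicalPhysics.KineticTheory.PointProcessVagueCompactness

/-!
# Tangent tightness, III: the reduction to two named facts of point-process theory (line `FirstLemma`, crux stmt-AtomisticToContinuum-14135)

`TangentTightness` (`…KiferTangent.lean`): every tangent family has, along a subsequence, a tangent state which is a
translation-invariant probability law on `PointConfig (ℝ³ × ℝ³)`. This file proves it FROM TWO NAMED FACTS of the
theory of random measures, recorded as NAMED FACTS in `Literature/MathematicalPhysics/KineticTheory/PointProcessVagueCompactness.lean`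
(the tree does not yet prove them: `PointConfigVagueTopology.lean`: "Deliberately NOT
here: … relative compactness criteria (A2.3 (ii)), the identification of vague cluster points with the
Laplace-functional cluster points … (Kallenberg Thm. 16.16)"; Mathlib's Prokhorov theorem is for Borel laws on metric
spaces, while `PointConfig` carries the count σ-algebra):

* `HardCoreLawsVaguelyCompact` — laws of `δ`-hard-core point processes in `ℝᵈ × ℝᵈ` are vaguely sequentially compact
  with hard-core probability limits (Kallenberg 2002, Lemma 16.15 + Thm. 16.16 + Thm. A2.3 (ii)). The hard core is
  the right hypothesis on SIMPLE configurations: with only uniformly bounded local intensities two points may merge in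
  the limit (`δ_{{0, 1/k}}` has Laplace functionals `→ e^{-2f(0)}`, the transform of the non-simple `2δ₀`), and the
  hard core makes the intensity bound automatic (packing);
* `LaplaceFunctionalDeterminesLaw` — the Laplace functional on `C_c⁺` determines a finite law on `PointConfig X`
  (Kallenberg 2002, Lemma 12.1);

and `stub_tangentTightnessOfFacts : HardCoreLawsVaguelyCompact → LaplaceFunctionalDeterminesLaw → TangentTightness`
(REGISTERED stub): the blown-up laws `blowUpLaw σ φ (N k) (Q k)` are probability laws whose Laplace functionals are
`tangentLaplace σ φ (N k) (Q k)` (`stub_laplaceFunctional_blowUpLaw`; `Q k` lives on the hard-sphere domain since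
`KL(Q k ‖ G) < ∞`) and which are `1`-hard-core almost surely (`stub_isHardCore_blowUp`,
`measurableSet_setOf_isHardCore`), so fact 1 gives `ι, μ`; translation invariance of `μ`:
`L_{μ ∘ τ_a⁻¹}(f) = L_μ(f(· + (a,0))) = lim tangentLaplace (f(· + (a,0))) = lim tangentLaplace f = L_μ(f)` by the
shift estimate `tendsto_tangentLaplace_translate_sub`, then fact 2. The registered `stub_tangentTightness` itself is
thereby closed MODULO the two facts.
-/

noncomputable section

open MeasureTheory ProbabilityTheory Set Filter Topology Function
open scoped ENNReal NNReal

namespace Summit.AtomisticToContinuum.HydrodynamicLimit.Theorems.KiferCompactification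

open Literature.MathematicalPhysics.KineticTheory (T3 V3 hsDiameter hsDiameter_pos localGibbsLaw blowUpPoint
  blowUp)
open Literature.MathematicalPhysics.KineticTheory.PointProcess (laplaceFunctional IsVagueClusterPoint
  HardCoreLawsVaguelyCompact LaplaceFunctionalDeterminesLaw)
open Literature.Analysis.FluidPDE (HardSphereFlow Config IsHardCore IsTranslationInvariant hardSphereDomain)
open Literature.Analysis.FunctionSpaces (PointConfig)

/-! ## The reduction -/

/-- **TIGHTNESS OF TANGENT FAMILIES FROM THE TWO FACTS.** Given vague sequential compactness of hard-core laws
(`HardCoreLawsVaguelyCompact`) and Laplace-functional uniqueness (`LaplaceFunctionalDeterminesLaw`), every tangent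
family has, along a subsequence, a tangent state which is a translation-invariant probability law
(`TangentTightness`). Registered stub `stub_tangentTightnessOfFacts` of line `FirstLemma`
(crux stmt-AtomisticToContinuum-14135); it closes the registered `stub_tangentTightness` modulo the two facts. -/
theorem stub_tangentTightnessOfFacts :
    HardCoreLawsVaguelyCompact → LaplaceFunctionalDeterminesLaw → TangentTightness := by
  intro hFact1 hFact2 σ a θ u₀ κ hσ _ha _hθ _hκ φ hφ hφ0 _hφ1 hφint N Φ Q hfam
  obtain ⟨hNk, hQprob, hKL, -⟩ := hfam
  haveI : ∀ k, IsProbabilityMeasure (Q k) := hQprob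
  haveI hw := isProbabilityMeasure_weightLaw hφ hφ0 hφint
  -- the blown-up laws: probability, `1`-hard-core almost surely
  have hD : ∀ k, ∀ᵐ z ∂Q k, z ∈ hardSphereDomain (Literature.Analysis.FluidPDE.Torus.geometry (Fin 3))
      (N k + 1) (hsDiameter σ (N k)) := fun k =>
    ae_mem_hardSphereDomain_of_klDiv_ne_top (ne_top_of_le_ne_top ENNReal.ofReal_ne_top (hKL k))
  have hPprob : ∀ k, IsProbabilityMeasure (blowUpLaw σ φ (N k) (Q k)) := fun k =>
    Measure.isProbabilityMeasure_map (measurable_blowUp _ _).aemeasurable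
  have hPcore : ∀ k, ∀ᵐ ω ∂(blowUpLaw σ φ (N k) (Q k)), IsHardCore 1 ω := fun k => by
    rw [blowUpLaw, ae_map_iff (measurable_blowUp _ _).aemeasurable (measurableSet_setOf_isHardCore 1)]
    filter_upwards [(Measure.quasiMeasurePreserving_snd).ae (hD k)] with p hp
    exact stub_isHardCore_blowUp (hsDiameter_pos hσ _) p.1 hp
  -- fact 1: a hard-core probability vague cluster point
  obtain ⟨μ, hμprob, -, ι, hι, hconv⟩ :=
    hFact1 (Fin 3) 1 one_pos (fun k => blowUpLaw σ φ (N k) (Q k)) hPprob hPcore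
  have hconv' : ∀ f : V3 × V3 → ℝ, Continuous f → HasCompactSupport f → (∀ p, 0 ≤ f p) →
      Tendsto (fun n => tangentLaplace σ φ (N (ι n)) (Q (ι n)) f) atTop (𝓝 (laplaceFunctional μ f)) := by
    intro f hf hfc hf0
    refine (hconv f hf hfc hf0).congr fun n => ?_
    exact stub_laplaceFunctional_blowUpLaw hσ hφ hφ0 hφint (Q (ι n)) (hD (ι n)) hf hfc hf0
  refine ⟨ι, μ, hμprob, ?_, hι, hconv'⟩
  -- translation invariance of the limit, by fact 2
  intro a'
  haveI := hμprob
  haveI : IsProbabilityMeasure (μ.map (PointConfig.translate ((a', 0) : V3 × V3))) :=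
    Measure.isProbabilityMeasure_map (PointConfig.measurable_translate _).aemeasurable
  refine hFact2 (V3 × V3) fun f hf hfc hf0 => ?_
  have hfa : Continuous fun p : V3 × V3 => f (p + (a', 0)) := hf.comp (continuous_add_const _)
  have hfac : HasCompactSupport fun p : V3 × V3 => f (p + (a', 0)) :=
    hfc.comp_homeomorph (Homeomorph.addRight ((a', 0) : V3 × V3))
  have hfa0 : ∀ p : V3 × V3, 0 ≤ f (p + (a', 0)) := fun p => hf0 _
  rw [laplaceFunctional_map_translate μ hf.measurable hfc hf0]
  have h1 := hconv' _ hfa hfac hfa0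
  have h2 := hconv' f hf hfc hf0
  have hN' : Tendsto (fun n => N (ι n)) atTop atTop :=
    tendsto_atTop_mono (fun n => (hι.id_le n).trans (hNk (ι n))) tendsto_id
  have h3 := tendsto_tangentLaplace_translate_sub hσ hφ hN' (fun n => Q (ι n)) (fun n => hQprob _) hf hfc hf0 a'
  have h4 : Tendsto (fun n => tangentLaplace σ φ (N (ι n)) (Q (ι n)) (fun p => f (p + (a', 0)))) atTop
      (𝓝 (0 + laplaceFunctional μ f)) := by
    refine (h3.add h2).congr fun n => ?_
    simp only [sub_add_cancel]
  rw [zero_add] at h4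
  exact tendsto_nhds_unique h1 h4

end Summit.AtomisticToContinuum.HydrodynamicLimit.Theorems.KiferCompactification
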